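import Literature.Analysis.Complex.RectangleCauchyDerivatives
import Mathlib.RingTheory.Binomial
import Mathlib.Algebra.BigOperators.NatAntidiagonal
import Mathlib.Analysis.SpecialFunctions.ExpDeriv
import HarnessLib

/-!
# The model double contour integral `∮∮ e^{L(s₁+s₂)} s₁^{−u−1} s₂^{−v−1} (s₁+s₂)^{−d} ds₁ ds₂`

Topic `Literature/Analysis/Complex`. Everything here is PROVED (theorems only).

Goldston–Pintz–Yıldırım, *Primes in tuples I*, §8, evaluate the main term of the two-variable
contour integral `𝒯*_R = (2πi)^{−2} ∫∫ D(s₁,s₂) R^{s₁+s₂} s₁^{−u−1} s₂^{−v−1} (s₁+s₂)^{−d} ds₁ ds₂`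
(their (8.1)) as the iterated residue at `s₁ = 0`, then `s₂ = 0` ((8.9)–(8.13)); the constant is
the binomial identity (8.12),
`(1/u!) ∑_{i ≤ u} C(u, i) (−1)^i d(d+1)⋯(d+i−1)/(v+d+i)! = C(u+v, u)/(u+v+d)!`,
giving the main term `G(0,0) C(u+v, u) (log R)^{u+v+d}/(u+v+d)!` ((8.13)). As they remark after
(8.13) (an observation of Motohashi, also Granville), the iterated residue is the double integral
over two small circles `|s₁| = ρ`, `|s₂| = 2ρ`. This file proves the rectangular version of that
model computation, in the tree's four-term convention `Literature.Analysis.Complex.rectBoundaryIntegral`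
(`ArgumentPrincipleRectangle.lean`) and with Cauchy's formula for derivatives on rectangles
(`RectangleCauchyDerivatives.lean`):

* `rectBoundaryIntegral_add_zpow_neg_mul_exp_div_pow` — **the inner residue**: for `η > 0` and
  `c` with a coordinate of absolute value `> η` (so `−c ∉ Q = [−η, η]²`),
  `∮_{∂Q} (s + c)^{−d} e^{Ls} s^{−u−1} ds = 2πi ∑_{i ≤ u} (−1)^i C(d+i−1, i) c^{−d−i} L^{u−i}/(u−i)!`
  (Leibniz: `iteratedDeriv_add_zpow_neg_mul_exp`);
* `rectBoundaryIntegral_rectBoundaryIntegral_exp_div` — **the model double integral**: for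
  `0 < η < η'`, `Q' = [−η', η']²`, any `L ∈ ℂ` and `u, v, d ∈ ℕ`,
  `∮_{∂Q'} ( ∮_{∂Q} e^{L(s₁+s₂)} / (s₁^{u+1} s₂^{v+1} (s₁+s₂)^d) ds₁ ) ds₂
    = (2πi)² C(u+v, u) L^{u+v+d}/(u+v+d)!`;
* `sum_negOnePow_choose_mul_choose` — the identity (8.12) in the cleared form
  `∑_{i ≤ u} (−1)^i C(d+i−1, i) C(u+v+d, u−i) = C(u+v, u)` (Chu–Vandermonde with upper index
  `−d`, from Mathlib's `Ring.add_choose_eq` and `Ring.choose_neg`);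
* Taylor-coefficient lemmas at `0` for `(s+c)^{−d}`, `(s+c)^{−d} e^{Ls}`, `s^m e^{Ls}`.

With `L = log R` and `D ≡ G(0,0)` this is exactly the main term (8.13) of GPY's Lemma 3 ((8.5));
the perturbation `D(s₁,s₂) − D(0,0)` and the contour shifts of §8 are not treated here.

## References

* D. A. Goldston, J. Pintz, C. Y. Yıldırım, *Primes in tuples. I*, Ann. of Math. (2) 170 (2009),
  819–862 = arXiv:math/0508185, §8: (8.1), (8.9)–(8.13) and the remark after (8.13).
  [cite: GoldstonPintzYildirim2009]
* L. V. Ahlfors, *Complex Analysis*, 3rd ed., 1979, Ch. 4 §2.3 (higher derivatives); folklore.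
-/

noncomputable section

open Complex Set Function Filter Topology

namespace Literature.Analysis.Complex

/-! ### The binomial identity (8.12) -/

/-- **GPY (8.12)**, cleared of factorials: `∑_{i ≤ u} (−1)^i C(d+i−1, i) C(u+v+d, u−i) = C(u+v, u)`
(for `d = 0` the `i = 0` term alone survives). This is Chu–Vandermonde
`C(−d + (u+v+d), u) = ∑_{i+j=u} C(−d, i) C(u+v+d, j)` in the binomial ring `ℤ`
(`Ring.add_choose_eq`) with `C(−d, i) = (−1)^i C(d+i−1, i)` (`Ring.choose_neg`). GPY's form
`(1/u!) ∑ C(u,i) (−1)^i d(d+1)⋯(d+i−1)/(v+d+i)! = C(u+v,u)/(u+v+d)!` is this one divided by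
`(u+v+d)!`, since `d(d+1)⋯(d+i−1) = i! C(d+i−1, i)`.
[cite: GoldstonPintzYildirim2009, eq. 8.12] -/
theorem sum_negOnePow_choose_mul_choose (u v d : ℕ) :
    ∑ i ∈ Finset.range (u + 1),
        (-1 : ℤ) ^ i * ((d + i - 1).choose i : ℤ) * ((u + v + d).choose (u - i) : ℤ) =
      ((u + v).choose u : ℤ) := by
  have h := Ring.add_choose_eq (r := (-(d : ℤ))) (s := ((u + v + d : ℕ) : ℤ)) u (Commute.all _ _)
  have hlhs : (-(d : ℤ)) + ((u + v + d : ℕ) : ℤ) = ((u + v : ℕ) : ℤ) := by push_cast; ring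
  rw [hlhs, Ring.choose_natCast] at h
  rw [h, Finset.Nat.sum_antidiagonal_eq_sum_range_succ_mk]
  refine Finset.sum_congr rfl fun i _ => ?_
  simp only [Ring.choose_natCast, Ring.choose_neg, Units.smul_def, Int.coe_negOnePow_natCast,
    smul_eq_mul]
  rcases Nat.eq_zero_or_pos (d + i) with h0 | hpos
  · obtain ⟨rfl, rfl⟩ : d = 0 ∧ i = 0 := by omega
    simp
  · have h1 : ((d : ℤ) + i - 1) = (((d + i - 1 : ℕ) : ℤ)) := by
      push_cast [Nat.one_le_iff_ne_zero.mpr (by omega : d + i ≠ 0)]; ring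
    rw [h1, Ring.choose_natCast]

/-! ### Taylor coefficients at `0` -/

/-- `∏_{j<i} (−d − j) = (−1)^i · i! · C(d+i−1, i)` (the falling factorial of `−d` is `(−1)^i`
times the rising factorial `d(d+1)⋯(d+i−1)`). [folklore] -/
theorem prod_range_neg_sub_eq (d i : ℕ) :
    ∏ j ∈ Finset.range i, (-(d : ℂ) - j) =
      (-1) ^ i * (i.factorial : ℂ) * ((d + i - 1).choose i : ℂ) := by
  have h1 : ∏ j ∈ Finset.range i, (-(d : ℂ) - j) =
      ∏ j ∈ Finset.range i, ((-1) * ((d : ℂ) + j)) :=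
    Finset.prod_congr rfl fun j _ => by ring
  have h2 : ∏ j ∈ Finset.range i, ((d : ℂ) + j) = ((d.ascFactorial i : ℕ) : ℂ) := by
    rw [Nat.ascFactorial_eq_prod_range]; push_cast; rfl
  rw [h1, Finset.prod_mul_distrib, Finset.prod_const, Finset.card_range, h2,
    Nat.ascFactorial_eq_factorial_mul_choose']
  push_cast; ring

/-- Derivatives of `s ↦ (s + c)^{−d}` at `0`: `(d/ds)^i (s + c)^{−d} |_{s=0} = (∏_{j<i} (−d−j)) c^{−d−i}`
(`iter_deriv_zpow` translated by `c`; for `c = 0` both sides are junk-valued and the identity still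
holds). [folklore] -/
theorem iteratedDeriv_add_zpow_neg (c : ℂ) (d i : ℕ) :
    iteratedDeriv i (fun s : ℂ => (s + c) ^ (-(d : ℤ))) 0 =
      (∏ j ∈ Finset.range i, (-(d : ℂ) - j)) * c ^ (-(d : ℤ) - i) := by
  have h := iteratedDeriv_comp_add_const i (fun y : ℂ => y ^ (-(d : ℤ))) c
  rw [h]
  simp only [zero_add]
  rw [iteratedDeriv_eq_iterate, iter_deriv_zpow]
  push_cast
  ring

/-- `s ↦ (s + c)^m` (`m ∈ ℤ`) is smooth at `s` when `s + c ≠ 0`. [folklore] -/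
theorem contDiffAt_add_zpow {c s : ℂ} (m : ℤ) (h : s + c ≠ 0) {n : WithTop ℕ∞} :
    ContDiffAt ℂ n (fun s : ℂ => (s + c) ^ m) s :=
  ((analyticAt_id.add analyticAt_const).zpow (by simpa using h)).contDiffAt

/-- **Leibniz.** The `u`-th Taylor coefficient at `0` of `s ↦ (s + c)^{−d} e^{Ls}` (`c ≠ 0`):
`(1/u!) (d/ds)^u [(s+c)^{−d} e^{Ls}]_{s=0} = ∑_{i ≤ u} (−1)^i C(d+i−1, i) c^{−d−i} L^{u−i}/(u−i)!`
(GPY §8, the two displays before (8.9), with `D ≡ 1`, `log R = L`).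
[cite: GoldstonPintzYildirim2009, §8 eq. 8.9] -/
theorem iteratedDeriv_add_zpow_neg_mul_exp (L c : ℂ) (hc : c ≠ 0) (d u : ℕ) :
    iteratedDeriv u (fun s : ℂ => (s + c) ^ (-(d : ℤ)) * cexp (L * s)) 0 / (u.factorial : ℂ) =
      ∑ i ∈ Finset.range (u + 1), (-1) ^ i * ((d + i - 1).choose i : ℂ) * c ^ (-(d : ℤ) - i) *
        (L ^ (u - i) / ((u - i).factorial : ℂ)) := by
  have hf : ContDiffAt ℂ u (fun s : ℂ => (s + c) ^ (-(d : ℤ))) 0 :=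
    contDiffAt_add_zpow _ (by simpa using hc)
  have hg : ContDiffAt ℂ u (fun s : ℂ => cexp (L * s)) 0 :=
    (Complex.contDiff_exp.comp (contDiff_const.mul contDiff_id)).contDiffAt
  rw [iteratedDeriv_fun_mul hf hg, Finset.sum_div]
  refine Finset.sum_congr rfl fun i hi => ?_
  have hiu : i ≤ u := Nat.lt_succ_iff.mp (Finset.mem_range.mp hi)
  rw [iteratedDeriv_add_zpow_neg, prod_range_neg_sub_eq, iteratedDeriv_cexp_const_mul]
  simp only [mul_zero, Complex.exp_zero, mul_one]
  rw [Nat.cast_choose ℂ hiu]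
  have h1 : (i.factorial : ℂ) ≠ 0 := by exact_mod_cast i.factorial_ne_zero
  have h2 : ((u - i).factorial : ℂ) ≠ 0 := by exact_mod_cast (u - i).factorial_ne_zero
  have h3 : (u.factorial : ℂ) ≠ 0 := by exact_mod_cast u.factorial_ne_zero
  field_simp

/-- Iterated derivatives of `s ↦ s^m` at `0`: `m!` for the `m`-th one, `0` otherwise. [folklore] -/
theorem iteratedDeriv_pow_apply_zero (m i : ℕ) :
    iteratedDeriv i (fun s : ℂ => s ^ m) 0 = if i = m then (m.factorial : ℂ) else 0 := by
  rw [iteratedDeriv_pow]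
  split_ifs with him
  · subst him; simp [Nat.descFactorial_self]
  · rcases Nat.lt_or_gt_of_ne him with hlt | hgt
    · rw [zero_pow (Nat.sub_ne_zero_of_lt hlt), mul_zero]
    · rw [Nat.descFactorial_eq_zero_iff_lt.mpr hgt]; simp

/-- The `n`-th Taylor coefficient at `0` of `s ↦ s^m e^{Ls}` is `L^{n−m}/(n−m)!` for `m ≤ n`
(Leibniz; only the term with `m` derivatives on `s^m` survives). [folklore] -/
theorem iteratedDeriv_pow_mul_exp (L : ℂ) {m n : ℕ} (hmn : m ≤ n) :
    iteratedDeriv n (fun s : ℂ => s ^ m * cexp (L * s)) 0 / (n.factorial : ℂ) =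
      L ^ (n - m) / ((n - m).factorial : ℂ) := by
  have hf : ContDiffAt ℂ n (fun s : ℂ => s ^ m) 0 := (contDiff_id.pow m).contDiffAt
  have hg : ContDiffAt ℂ n (fun s : ℂ => cexp (L * s)) 0 :=
    (Complex.contDiff_exp.comp (contDiff_const.mul contDiff_id)).contDiffAt
  rw [iteratedDeriv_fun_mul hf hg]
  simp only [iteratedDeriv_cexp_const_mul, mul_zero, Complex.exp_zero, mul_one,
    iteratedDeriv_pow_apply_zero, mul_ite, mul_zero, ite_mul, zero_mul, Finset.sum_ite_eq',
    Finset.mem_range, Nat.lt_succ_of_le hmn, if_true]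
  rw [Nat.cast_choose ℂ hmn]
  have h1 : (m.factorial : ℂ) ≠ 0 := by exact_mod_cast m.factorial_ne_zero
  have h2 : ((n - m).factorial : ℂ) ≠ 0 := by exact_mod_cast (n - m).factorial_ne_zero
  have h3 : (n.factorial : ℂ) ≠ 0 := by exact_mod_cast n.factorial_ne_zero
  field_simp

/-! ### The inner residue -/

variable {η η' : ℝ}

/-- A point of the closed square `[−η, η]²` has both coordinates of absolute value `≤ η`; so if
`c` has a coordinate of absolute value `> η`, then `s + c ≠ 0` for `s` in the square. [folklore] -/
theorem add_ne_zero_of_mem_square {c s : ℂ} (hc : η < |c.re| ∨ η < |c.im|)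
    (hs : s ∈ Icc (-η) η ×ℂ Icc (-η) η) : s + c ≠ 0 := by
  intro h0
  have hre : s.re = -c.re := by have := congrArg Complex.re h0; simp at this; linarith
  have him : s.im = -c.im := by have := congrArg Complex.im h0; simp at this; linarith
  obtain ⟨⟨h1, h2⟩, ⟨h3, h4⟩⟩ := mem_reProdIm.1 hs
  rcases hc with h | h
  · rw [hre] at h1 h2
    have : |c.re| ≤ η := abs_le.2 ⟨by linarith, by linarith⟩
    linarith
  · rw [him] at h3 h4
    have : |c.im| ≤ η := abs_le.2 ⟨by linarith, by linarith⟩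
    linarith

/-- **The inner residue.** For `η > 0`, `c ∈ ℂ` with a coordinate of absolute value `> η` (so that
`−c` lies outside the closed square `Q = [−η, η]²`), `L ∈ ℂ` and `u, d ∈ ℕ`:
`∮_{∂Q} (s + c)^{−d} e^{Ls} / s^{u+1} ds = 2πi ∑_{i ≤ u} (−1)^i C(d+i−1, i) c^{−d−i} L^{u−i}/(u−i)!`
— Cauchy's formula for the `u`-th derivative at the only pole `s = 0`
(`rectBoundaryIntegral_div_pow_succ_eq_iteratedDeriv` on the open set `{s : s + c ≠ 0} ⊇ Q`) and
`iteratedDeriv_add_zpow_neg_mul_exp`. This is GPY's `Res_{s₁=0}` of (8.9) for `D ≡ 1`.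
[cite: GoldstonPintzYildirim2009, §8 eq. 8.9] -/
theorem rectBoundaryIntegral_add_zpow_neg_mul_exp_div_pow (hη : 0 < η) {c : ℂ}
    (hc : η < |c.re| ∨ η < |c.im|) (L : ℂ) (d u : ℕ) :
    rectBoundaryIntegral (fun s : ℂ => (s + c) ^ (-(d : ℤ)) * cexp (L * s) / s ^ (u + 1))
        (-η) η (-η) η =
      2 * Real.pi * I * ∑ i ∈ Finset.range (u + 1),
        (-1) ^ i * ((d + i - 1).choose i : ℂ) * c ^ (-(d : ℤ) - i) *
          (L ^ (u - i) / ((u - i).factorial : ℂ)) := by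
  have hc0 : c ≠ 0 := by
    rintro rfl
    simp only [zero_re, abs_zero, zero_im, or_self] at hc
    linarith
  set U : Set ℂ := {s : ℂ | s + c ≠ 0}
  have hUo : IsOpen U := isOpen_ne_fun (by fun_prop) (by fun_prop)
  have hQU : Icc (-η) η ×ℂ Icc (-η) η ⊆ U := fun s hs => add_ne_zero_of_mem_square hc hs
  have hf : DifferentiableOn ℂ (fun s : ℂ => (s + c) ^ (-(d : ℤ)) * cexp (L * s)) U := by
    intro s hs
    exact (((differentiableAt_id.add (differentiableAt_const c)).zpow (Or.inl hs)).mul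
      ((differentiableAt_const L).mul differentiableAt_id).cexp).differentiableWithinAt
  have h := rectBoundaryIntegral_div_pow_succ_eq_iteratedDeriv hUo 0 u
    (by simp; exact hη) (by simp; exact hη) (by simp; exact hη) (by simp; exact hη) hQU hf
  simp only [sub_zero] at h
  rw [h, iteratedDeriv_add_zpow_neg_mul_exp L c hc0 d u]

/-! ### The model double integral -/

/-- Factorisation of the model integrand for fixed `s₂` (a field identity, junk values included):
`e^{L(s₁+s₂)}/(s₁^{u+1} s₂^{v+1} (s₁+s₂)^d) = e^{Ls₂} s₂^{−(v+1)} · (s₁+s₂)^{−d} e^{Ls₁}/s₁^{u+1}`.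
[folklore] -/
theorem exp_mul_add_div_eq (L : ℂ) (u v d : ℕ) (s₁ s₂ : ℂ) :
    cexp (L * (s₁ + s₂)) / (s₁ ^ (u + 1) * s₂ ^ (v + 1) * (s₁ + s₂) ^ d) =
      cexp (L * s₂) * (s₂ ^ (v + 1))⁻¹ *
        ((s₁ + s₂) ^ (-(d : ℤ)) * cexp (L * s₁) / s₁ ^ (u + 1)) := by
  rw [mul_add, Complex.exp_add, zpow_neg, zpow_natCast]
  ring

/-- For `s ≠ 0` and `i ≤ u`: `e^{Ls} s^{−(v+1)} s^{−d−i} = s^{u−i} e^{Ls} / s^{u+v+d+1}`. [folklore] -/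
theorem exp_mul_inv_pow_mul_zpow {s : ℂ} (hs : s ≠ 0) (L : ℂ) {u v d i : ℕ} (hi : i ≤ u) :
    cexp (L * s) * (s ^ (v + 1))⁻¹ * s ^ (-(d : ℤ) - i) =
      s ^ (u - i) * cexp (L * s) / s ^ (u + v + d + 1) := by
  have hz : s ^ (-(d : ℤ) - i) = (s ^ (d + i))⁻¹ := by
    rw [show (-(d : ℤ) - i) = -((d + i : ℕ) : ℤ) by push_cast; ring, zpow_neg, zpow_natCast]
  have hsplit : s ^ (u + v + d + 1) = s ^ (u - i) * s ^ (v + 1) * s ^ (d + i) := by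
    rw [← pow_add, ← pow_add]; congr 1; omega
  rw [hz, hsplit]
  field_simp

/-- **The model double integral of GPY §8** (rectangular form of the remark after (8.13)). For
`0 < η < η'`, `L ∈ ℂ` and `u, v, d ∈ ℕ`, with `Q = [−η, η]²`, `Q' = [−η', η']²` (four-term
convention, both counter-clockwise):
`∮_{∂Q'} ( ∮_{∂Q} e^{L(s₁+s₂)} / (s₁^{u+1} s₂^{v+1} (s₁+s₂)^d) ds₁ ) ds₂
  = (2πi)² · C(u+v, u) L^{u+v+d} / (u+v+d)!`.
Proof: for `s₂ ∈ ∂Q'` the inner integrand has in `Q` only the pole `s₁ = 0` (`−s₂ ∉ Q`), and by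
`rectBoundaryIntegral_add_zpow_neg_mul_exp_div_pow` the inner integral is
`2πi e^{Ls₂} s₂^{−v−1} ∑_{i≤u} (−1)^i C(d+i−1,i) s₂^{−d−i} L^{u−i}/(u−i)! = G(s₂)/s₂^{u+v+d+1}` with
`G(s) = 2πi ∑_{i≤u} (−1)^i C(d+i−1,i) (L^{u−i}/(u−i)!) s^{u−i} e^{Ls}` entire; so the outer
integral is `2πi G^{(u+v+d)}(0)/(u+v+d)!` (`rectBoundaryIntegral_div_pow_succ_eq_iteratedDeriv`)
`= (2πi)² L^{u+v+d} ∑_{i≤u} (−1)^i C(d+i−1,i)/((u−i)!(v+d+i)!)` (`iteratedDeriv_pow_mul_exp`), and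
the last sum is `C(u+v,u)/(u+v+d)!` by (8.12) (`sum_negOnePow_choose_mul_choose`). With
`L = log R` this is the main term (8.13) of GPY's Lemma 3 for `D ≡ 1`.
[cite: GoldstonPintzYildirim2009, §8 eq. 8.13 and the remark following it] -/
theorem rectBoundaryIntegral_rectBoundaryIntegral_exp_div (hη : 0 < η) (hη' : η < η') (L : ℂ)
    (u v d : ℕ) :
    rectBoundaryIntegral (fun s₂ => rectBoundaryIntegral
        (fun s₁ => cexp (L * (s₁ + s₂)) / (s₁ ^ (u + 1) * s₂ ^ (v + 1) * (s₁ + s₂) ^ d))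
        (-η) η (-η) η) (-η') η' (-η') η' =
      (2 * Real.pi * I) ^ 2 * (((u + v).choose u : ℂ) * L ^ (u + v + d) /
        ((u + v + d).factorial : ℂ)) := by
  set n := u + v + d with hn
  -- coefficients of the inner residue
  set a : ℕ → ℂ := fun i => (-1) ^ i * ((d + i - 1).choose i : ℂ) * (L ^ (u - i) /
    ((u - i).factorial : ℂ)) with ha
  -- the entire numerator of the outer integrand
  set G : ℂ → ℂ := fun s => 2 * Real.pi * I * ∑ i ∈ Finset.range (u + 1),
    a i * (s ^ (u - i) * cexp (L * s)) with hG
  -- Step 1: the inner integral at a point `s₂` with a coordinate of absolute value `> η`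
  have hinner : ∀ s₂ : ℂ, (η < |s₂.re| ∨ η < |s₂.im|) →
      rectBoundaryIntegral
          (fun s₁ => cexp (L * (s₁ + s₂)) / (s₁ ^ (u + 1) * s₂ ^ (v + 1) * (s₁ + s₂) ^ d))
          (-η) η (-η) η =
        G s₂ / (s₂ - 0) ^ (n + 1) := by
    intro s₂ hs₂
    have hs0 : s₂ ≠ 0 := by
      rintro rfl
      simp only [zero_re, abs_zero, zero_im, or_self] at hs₂
      linarith
    have hfun : (fun s₁ => cexp (L * (s₁ + s₂)) / (s₁ ^ (u + 1) * s₂ ^ (v + 1) * (s₁ + s₂) ^ d))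
        = fun s₁ => cexp (L * s₂) * (s₂ ^ (v + 1))⁻¹ *
          ((s₁ + s₂) ^ (-(d : ℤ)) * cexp (L * s₁) / s₁ ^ (u + 1)) :=
      funext fun s₁ => exp_mul_add_div_eq L u v d s₁ s₂
    rw [hfun, rectBoundaryIntegral_const_mul,
      rectBoundaryIntegral_add_zpow_neg_mul_exp_div_pow hη hs₂ L d u, sub_zero, hG]
    simp only
    rw [Finset.mul_sum, Finset.mul_sum, Finset.mul_sum, Finset.sum_div]
    refine Finset.sum_congr rfl fun i hi => ?_
    have hiu : i ≤ u := Nat.lt_succ_iff.mp (Finset.mem_range.mp hi)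
    have key := exp_mul_inv_pow_mul_zpow hs0 L (v := v) (d := d) hiu
    rw [ha]
    simp only
    rw [← hn] at key
    calc cexp (L * s₂) * (s₂ ^ (v + 1))⁻¹ * (2 * Real.pi * I *
          ((-1) ^ i * ((d + i - 1).choose i : ℂ) * s₂ ^ (-(d : ℤ) - i) *
            (L ^ (u - i) / ((u - i).factorial : ℂ))))
        = 2 * Real.pi * I * ((-1) ^ i * ((d + i - 1).choose i : ℂ) *
            (L ^ (u - i) / ((u - i).factorial : ℂ))) *
            (cexp (L * s₂) * (s₂ ^ (v + 1))⁻¹ * s₂ ^ (-(d : ℤ) - i)) := by ring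
      _ = 2 * Real.pi * I * ((-1) ^ i * ((d + i - 1).choose i : ℂ) *
            (L ^ (u - i) / ((u - i).factorial : ℂ))) *
            (s₂ ^ (u - i) * cexp (L * s₂) / s₂ ^ (n + 1)) := by rw [key]
      _ = _ := by ring
  -- Step 2: rewrite the outer integrand on the four edges of `Q'`
  have hη'0 : 0 < η' := hη.trans hη'
  have hle' : -η' ≤ η' := by linarith
  have hedge_h : ∀ (y : ℝ), |y| = η' → ∀ x ∈ Icc (-η') η',
      rectBoundaryIntegral
          (fun s₁ => cexp (L * (s₁ + (x + y * I))) /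
            (s₁ ^ (u + 1) * (x + y * I) ^ (v + 1) * (s₁ + (x + y * I)) ^ d)) (-η) η (-η) η =
        G (x + y * I) / ((x + y * I) - 0) ^ (n + 1) := by
    intro y hy x _
    refine hinner _ (Or.inr ?_)
    simpa [hy] using hη'
  have hedge_v : ∀ (x : ℝ), |x| = η' → ∀ y ∈ Icc (-η') η',
      rectBoundaryIntegral
          (fun s₁ => cexp (L * (s₁ + (x + y * I))) /
            (s₁ ^ (u + 1) * (x + y * I) ^ (v + 1) * (s₁ + (x + y * I)) ^ d)) (-η) η (-η) η =
        G (x + y * I) / ((x + y * I) - 0) ^ (n + 1) := by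
    intro x hx y _
    refine hinner _ (Or.inl ?_)
    simpa [hx] using hη'
  rw [rectBoundaryIntegral_congr (G := fun s₂ => G s₂ / (s₂ - 0) ^ (n + 1)) hle' hle'
    (hedge_h (-η') (by rw [abs_neg, abs_of_pos hη'0]))
    (hedge_h η' (abs_of_pos hη'0))
    (hedge_v (-η') (by rw [abs_neg, abs_of_pos hη'0]))
    (hedge_v η' (abs_of_pos hη'0))]
  -- Step 3: Cauchy's formula for the `n`-th derivative of the entire function `G`
  have hGd : DifferentiableOn ℂ G univ := by
    intro s _
    refine DifferentiableAt.differentiableWithinAt ?_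
    simp only [hG]
    fun_prop
  rw [rectBoundaryIntegral_div_pow_succ_eq_iteratedDeriv isOpen_univ 0 n
    (by simp; exact hη'0) (by simp; exact hη'0) (by simp; exact hη'0) (by simp; exact hη'0)
    (subset_univ _) hGd]
  -- Step 4: the Taylor coefficient of `G`
  have hcd : ∀ i ∈ Finset.range (u + 1),
      ContDiffAt ℂ n (fun s : ℂ => a i * (s ^ (u - i) * cexp (L * s))) 0 := by
    intro i _
    exact contDiffAt_const.mul ((contDiff_id.pow _).contDiffAt.mul
      (Complex.contDiff_exp.comp (contDiff_const.mul contDiff_id)).contDiffAt)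
  have hGn : iteratedDeriv n G 0 / (n.factorial : ℂ) = 2 * Real.pi * I *
      ∑ i ∈ Finset.range (u + 1), a i * (L ^ (n - (u - i)) / ((n - (u - i)).factorial : ℂ)) := by
    simp only [hG]
    rw [iteratedDeriv_const_mul _ (ContDiffAt.sum hcd), iteratedDeriv_fun_sum hcd,
      mul_div_assoc, Finset.sum_div]
    congr 1
    refine Finset.sum_congr rfl fun i hi => ?_
    have hcd' : ContDiffAt ℂ n (fun s : ℂ => s ^ (u - i) * cexp (L * s)) 0 :=
      (contDiff_id.pow _).contDiffAt.mul
        (Complex.contDiff_exp.comp (contDiff_const.mul contDiff_id)).contDiffAt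
    rw [iteratedDeriv_const_mul _ hcd', mul_div_assoc,
      iteratedDeriv_pow_mul_exp L (by omega : u - i ≤ n)]
  rw [hGn]
  -- Step 5: algebra and (8.12)
  have hsum : ∑ i ∈ Finset.range (u + 1),
      a i * (L ^ (n - (u - i)) / ((n - (u - i)).factorial : ℂ)) =
        ((u + v).choose u : ℂ) * L ^ n / (n.factorial : ℂ) := by
    have hcomb : ∑ i ∈ Finset.range (u + 1),
        (-1 : ℂ) ^ i * ((d + i - 1).choose i : ℂ) * ((u + v + d).choose (u - i) : ℂ) =
          ((u + v).choose u : ℂ) := by exact_mod_cast sum_negOnePow_choose_mul_choose u v d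
    rw [← hcomb, Finset.sum_mul, Finset.sum_div]
    refine Finset.sum_congr rfl fun i hi => ?_
    have hiu : i ≤ u := Nat.lt_succ_iff.mp (Finset.mem_range.mp hi)
    have h1 : n - (u - i) = v + d + i := by omega
    have h2 : u - i ≤ u + v + d := by omega
    rw [ha, h1]
    simp only
    rw [Nat.cast_choose ℂ h2, show u + v + d - (u - i) = v + d + i by omega]
    have f1 : ((u - i).factorial : ℂ) ≠ 0 := by exact_mod_cast (u - i).factorial_ne_zero
    have f2 : ((v + d + i).factorial : ℂ) ≠ 0 := by exact_mod_cast (v + d + i).factorial_ne_zero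
    have f3 : (n.factorial : ℂ) ≠ 0 := by exact_mod_cast n.factorial_ne_zero
    have hL : L ^ (u - i) * L ^ (v + d + i) = L ^ n := by rw [← pow_add]; congr 1; omega
    rw [hn] at f3 ⊢
    field_simp
    rw [← hn, ← hL]
    ring
  rw [hsum]
  ring

end Literature.Analysis.Complex
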